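import Mathlib
import HarnessLib
import Summits.HubbardSuperconductivity.HubbardSuperconductivity.Theorems.KLProgrammeKLRegimeCountertermJacksonFrame

/-!
# Route `KLProgramme` — crux K3, child Counterterm under Δ23 / (R-I-min): bounds for the Jackson mean — positivity, linearity, value error (part 3 of the smoothing layer)

For the Jackson mean `𝒥_d F = jsmooth d F` of `…CountertermJacksonFrame` (`= (jacksonFrame d F).eval` on symmetric frames):

* §5 `jsmooth_const` (constants reproduced — the angular mean / δμ flow is untouched), `jsmooth_const_mul`, `jsmooth_add`, `jsmooth_neg`, `jsmooth_sub`,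
  `jsmooth_finset_sum` (linearity: the multi-slot re-slotting of FrameOK (ii) passes through `𝒥_d` piece by piece), **`abs_jsmooth_le`**
  (`|𝒥_d F(p)| ≤ sup|F|` — nonnegative kernel of mass one: the `j = 0` size with CONSTANT ONE) and **`abs_jsmooth_sub_jsmooth_le`**
  (`|𝒥_d F − 𝒥_d G| ≤ sup|F − G|`: the contraction / `frameDist` bound passes with constant one);
* §6 `integral_abs_mul_jker_le` (first absolute moment `∫|s|J̃_d ≤ π⁶/(2(d+1))` via the arctangent integral of the tree's u⁻⁴ tail),
  `abs_sub_le_of_fderiv_le`, and **`abs_jsmooth_sub_self_le` (J3): `|𝒥_d F(p) − F(p)| ≤ π⁶·B₁/(d+1)`** for a continuous `F` whose Euclidean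
  gradient is bounded by `B₁` — only ONE derivative is spent and `d` is free, so child Counterterm picks `d(β,U,G,R)` after `β` and before the volume
  to put this below its renormalisation tolerance (`CountertermP2`'s quantifier order; `d` never meets `L`).

Pure real analysis.  Seat hubbard-kl-k3c3-p2 (g3); HOME/hubbard-kl-k3c3-p2/DELTA23-CHILD2.md §3.
-/

noncomputable section

namespace Summit.HubbardSuperconductivity.HubbardSuperconductivity.Theorems.KLRegimeSplit

set_option linter.dupNamespace false -- summit = problem name (single-conjunct summit), D-0017

open Real Finset MeasureTheory intervalIntegral
open Literature.Analysis.Fourier.TrigApprox Literature.MathematicalPhysics.QuantumLattice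

/-! ## §5 Algebra of the Jackson mean: constants, linearity, positivity -/

section Algebra

variable (d : ℕ) {F G : (Fin 2 → ℝ) → ℝ}

/-- Joint continuity of the smoothing integrand `(s,t) ↦ J̃(s) J̃(t) F(p₀−s, p₁−t)`. -/
theorem continuous_jsmoothIntegrand (hF : Continuous F) (p : Fin 2 → ℝ) :
    Continuous (Function.uncurry fun s t : ℝ => jker d s * jker d t * F ![p 0 - s, p 1 - t]) := by
  have h1 : Continuous fun q : ℝ × ℝ => F ![p 0 - q.1, p 1 - q.2] := by
    refine hF.comp (continuous_pi fun i => ?_)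
    fin_cases i <;> simp <;> fun_prop
  exact (((continuous_jker d).comp continuous_fst).mul ((continuous_jker d).comp continuous_snd)).mul h1

/-- Continuity of the `t`-section of the smoothing integrand. -/
theorem continuous_jsmoothIntegrand_snd (hF : Continuous F) (p : Fin 2 → ℝ) (s : ℝ) :
    Continuous fun t : ℝ => jker d s * jker d t * F ![p 0 - s, p 1 - t] := by
  have h1 : Continuous fun t : ℝ => F ![p 0 - s, p 1 - t] := by
    refine hF.comp (continuous_pi fun i => ?_)
    fin_cases i <;> simp <;> fun_prop
  exact (continuous_const.mul (continuous_jker d)).mul h1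

/-- Continuity of the inner integral in the outer variable. -/
theorem continuous_jsmoothInner (hF : Continuous F) (p : Fin 2 → ℝ) :
    Continuous fun s : ℝ => ∫ t in (-π)..π, jker d s * jker d t * F ![p 0 - s, p 1 - t] :=
  intervalIntegral.continuous_parametric_intervalIntegral_of_continuous' (continuous_jsmoothIntegrand d hF p) _ _

/-- **Constants are reproduced**: `𝒥_d c = c` (mass one twice). -/
theorem jsmooth_const (c : ℝ) (p : Fin 2 → ℝ) : jsmooth d (fun _ => c) p = c := by
  unfold jsmooth
  have hinner : ∀ s, (∫ t in (-π)..π, jker d s * jker d t * c) = jker d s * c := by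
    intro s
    rw [show (fun t => jker d s * jker d t * c) = fun t => jker d s * c * jker d t from funext fun t => by ring,
      intervalIntegral.integral_const_mul, integral_jker, mul_one]
  simp_rw [hinner]
  rw [intervalIntegral.integral_mul_const, integral_jker, one_mul]

/-- Homogeneity: `𝒥_d (c·F) = c·𝒥_d F`. -/
theorem jsmooth_const_mul (c : ℝ) (p : Fin 2 → ℝ) : jsmooth d (fun q => c * F q) p = c * jsmooth d F p := by
  unfold jsmooth
  rw [← intervalIntegral.integral_const_mul]
  refine intervalIntegral.integral_congr fun s _ => ?_
  show (∫ t in (-π)..π, jker d s * jker d t * (c * F ![p 0 - s, p 1 - t])) =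
    c * ∫ t in (-π)..π, jker d s * jker d t * F ![p 0 - s, p 1 - t]
  rw [← intervalIntegral.integral_const_mul]
  exact intervalIntegral.integral_congr fun t _ => by ring

/-- Additivity: `𝒥_d (F + G) = 𝒥_d F + 𝒥_d G` (continuous `F`, `G`). -/
theorem jsmooth_add (hF : Continuous F) (hG : Continuous G) (p : Fin 2 → ℝ) :
    jsmooth d (fun q => F q + G q) p = jsmooth d F p + jsmooth d G p := by
  unfold jsmooth
  rw [← intervalIntegral.integral_add ((continuous_jsmoothInner d hF p).intervalIntegrable _ _)
    ((continuous_jsmoothInner d hG p).intervalIntegrable _ _)]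
  refine intervalIntegral.integral_congr fun s _ => ?_
  show (∫ t in (-π)..π, jker d s * jker d t * (F ![p 0 - s, p 1 - t] + G ![p 0 - s, p 1 - t])) =
    (∫ t in (-π)..π, jker d s * jker d t * F ![p 0 - s, p 1 - t]) + ∫ t in (-π)..π, jker d s * jker d t * G ![p 0 - s, p 1 - t]
  rw [← intervalIntegral.integral_add ((continuous_jsmoothIntegrand_snd d hF p s).intervalIntegrable _ _)
    ((continuous_jsmoothIntegrand_snd d hG p s).intervalIntegrable _ _)]
  exact intervalIntegral.integral_congr fun t _ => by ring

/-- `𝒥_d (−F) = −𝒥_d F`. -/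
theorem jsmooth_neg (p : Fin 2 → ℝ) : jsmooth d (fun q => -F q) p = -jsmooth d F p := by
  have h := jsmooth_const_mul d (F := F) (-1) p
  simp only [neg_mul, one_mul] at h
  exact h

/-- `𝒥_d (F − G) = 𝒥_d F − 𝒥_d G` (continuous `F`, `G`). -/
theorem jsmooth_sub (hF : Continuous F) (hG : Continuous G) (p : Fin 2 → ℝ) :
    jsmooth d (fun q => F q - G q) p = jsmooth d F p - jsmooth d G p := by
  have h := jsmooth_add d hF (show Continuous (fun q => -G q) from hG.neg) p
  rw [jsmooth_neg] at h
  simp only [← sub_eq_add_neg] at h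
  exact h

/-- Finite additivity: `𝒥_d (Σ_i F_i) = Σ_i 𝒥_d F_i` (continuous summands). -/
theorem jsmooth_finset_sum {ι : Type*} (S : Finset ι) (Fs : ι → (Fin 2 → ℝ) → ℝ) (hFs : ∀ i ∈ S, Continuous (Fs i))
    (p : Fin 2 → ℝ) : jsmooth d (fun q => ∑ i ∈ S, Fs i q) p = ∑ i ∈ S, jsmooth d (Fs i) p := by
  classical
  induction S using Finset.induction_on with
  | empty => simp [jsmooth_const]
  | insert a S ha ih =>
    have hS : ∀ i ∈ S, Continuous (Fs i) := fun i hi => hFs i (Finset.mem_insert_of_mem hi)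
    have hsum : Continuous fun q => ∑ i ∈ S, Fs i q := continuous_finsetSum S fun i hi => hS i hi
    simp_rw [Finset.sum_insert ha]
    rw [jsmooth_add d (hFs a (Finset.mem_insert_self a S)) hsum, ih hS]

/-- **Positivity / sup bound**: `|𝒥_d F(p)| ≤ sup |F|` — the kernel is nonnegative of mass one. -/
theorem abs_jsmooth_le (hF : Continuous F) {B : ℝ} (hB : ∀ q, |F q| ≤ B) (p : Fin 2 → ℝ) : |jsmooth d F p| ≤ B := by
  unfold jsmooth
  have hππ : -π ≤ π := by linarith [Real.pi_pos]
  have hinner : ∀ s, |∫ t in (-π)..π, jker d s * jker d t * F ![p 0 - s, p 1 - t]| ≤ jker d s * B := by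
    intro s
    calc |∫ t in (-π)..π, jker d s * jker d t * F ![p 0 - s, p 1 - t]|
        ≤ ∫ t in (-π)..π, |jker d s * jker d t * F ![p 0 - s, p 1 - t]| :=
          intervalIntegral.abs_integral_le_integral_abs hππ
      _ ≤ ∫ t in (-π)..π, jker d s * B * jker d t := by
          refine intervalIntegral.integral_mono_on hππ
            ((continuous_jsmoothIntegrand_snd d hF p s).abs.intervalIntegrable _ _)
            ((continuous_const.mul (continuous_jker d)).intervalIntegrable _ _) fun t _ => ?_
          rw [abs_mul, abs_mul, abs_of_nonneg (jker_nonneg d s), abs_of_nonneg (jker_nonneg d t)]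
          have := hB ![p 0 - s, p 1 - t]
          have hj : 0 ≤ jker d s * jker d t := mul_nonneg (jker_nonneg d s) (jker_nonneg d t)
          nlinarith
      _ = jker d s * B := by rw [intervalIntegral.integral_const_mul, integral_jker, mul_one]
  calc |∫ s in (-π)..π, ∫ t in (-π)..π, jker d s * jker d t * F ![p 0 - s, p 1 - t]|
      ≤ ∫ s in (-π)..π, |∫ t in (-π)..π, jker d s * jker d t * F ![p 0 - s, p 1 - t]| :=
        intervalIntegral.abs_integral_le_integral_abs hππ
    _ ≤ ∫ s in (-π)..π, jker d s * B :=
        intervalIntegral.integral_mono_on hππ ((continuous_jsmoothInner d hF p).abs.intervalIntegrable _ _)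
          (((continuous_jker d).mul continuous_const).intervalIntegrable _ _) fun s _ => hinner s
    _ = B := by rw [intervalIntegral.integral_mul_const, integral_jker, one_mul]

/-- **Lipschitz in the symbol (constant one)**: `|𝒥_d F(p) − 𝒥_d G(p)| ≤ sup|F − G|`. -/
theorem abs_jsmooth_sub_jsmooth_le (hF : Continuous F) (hG : Continuous G) {B : ℝ} (hB : ∀ q, |F q - G q| ≤ B)
    (p : Fin 2 → ℝ) : |jsmooth d F p - jsmooth d G p| ≤ B := by
  rw [← jsmooth_sub d hF hG]
  exact abs_jsmooth_le d (hF.sub hG) hB p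

end Algebra

/-! ## §6 The first absolute moment of the kernel and the value error of the Jackson mean -/

/-- **First absolute moment**: `∫_{−π}^{π} |s| J̃_d(s) ds ≤ π⁶/(2(d+1))`. -/
theorem integral_abs_mul_jker_le (d : ℕ) : ∫ s in (-π)..π, |s| * jker d s ≤ π ^ 6 / (2 * (d + 1)) := by
  have h2π : (2 * π : ℝ) ≠ 0 := by positivity
  have hd : (0 : ℝ) < d + 1 := by positivity
  -- substitution `s = 2π x`
  have hsub : ∫ s in (-π)..π, |s| * jker d s = (2 * π) * ∫ x in (-(1 / 2 : ℝ))..(1 / 2), |x| * jackson d x := by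
    have hpt : ∀ s, |s| * jker d s = (fun x => |x| * jackson d x) (s / (2 * π)) := by
      intro s
      simp only [jker]
      rw [abs_div, abs_of_pos (by positivity : (0 : ℝ) < 2 * π)]
      field_simp
    rw [intervalIntegral.integral_congr fun s _ => hpt s, intervalIntegral.integral_comp_div (fun x => |x| * jackson d x) h2π,
      show -π / (2 * π) = -(1 / 2 : ℝ) by field_simp, show π / (2 * π) = (1 / 2 : ℝ) by field_simp, smul_eq_mul]
  rw [hsub]
  -- the pointwise majorant
  have hcont : Continuous fun x : ℝ => (π ^ 4 / 4) / (1 + ((d + 1) * x) ^ 2) :=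
    continuous_const.div (by fun_prop) fun x => by positivity
  have hmaj : ∫ x in (-(1 / 2 : ℝ))..(1 / 2), |x| * jackson d x ≤
      ∫ x in (-(1 / 2 : ℝ))..(1 / 2), (π ^ 4 / 4) / (1 + ((d + 1) * x) ^ 2) := by
    refine intervalIntegral.integral_mono_on (by norm_num)
      ((continuous_abs.mul (continuous_jackson d)).intervalIntegrable _ _) (hcont.intervalIntegrable _ _)
      fun x hx => abs_mul_jackson_le d ?_
    rw [abs_le]; exact ⟨by linarith [hx.1], by linarith [hx.2]⟩
  -- the arctangent integral
  have harc : ∫ x in (-(1 / 2 : ℝ))..(1 / 2), (π ^ 4 / 4) / (1 + ((d + 1) * x) ^ 2) ≤ (π ^ 4 / 4) * (π / (d + 1)) := by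
    have hfun : (fun x : ℝ => (π ^ 4 / 4) / (1 + ((d + 1) * x) ^ 2)) =
        fun x => (π ^ 4 / 4) * ((fun y : ℝ => (1 + y ^ 2)⁻¹) ((d + 1) * x)) := by
      funext x; simp only [div_eq_mul_inv]
    rw [hfun, intervalIntegral.integral_const_mul,
      intervalIntegral.integral_comp_mul_left (fun y : ℝ => (1 + y ^ 2)⁻¹) hd.ne', integral_inv_one_add_sq, smul_eq_mul]
    have h1 := Real.arctan_lt_pi_div_two ((d + 1 : ℝ) * (1 / 2))
    have h2 := Real.neg_pi_div_two_lt_arctan ((d + 1 : ℝ) * -(1 / 2))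
    have hπ4 : (0 : ℝ) ≤ π ^ 4 / 4 := by positivity
    apply mul_le_mul_of_nonneg_left _ hπ4
    rw [inv_mul_le_iff₀ hd, show (d + 1 : ℝ) * (π / (d + 1)) = π by field_simp]
    linarith
  calc (2 * π) * ∫ x in (-(1 / 2 : ℝ))..(1 / 2), |x| * jackson d x
      ≤ (2 * π) * ((π ^ 4 / 4) * (π / (d + 1))) := by
        exact mul_le_mul_of_nonneg_left (hmaj.trans harc) (by positivity)
    _ = π ^ 6 / (2 * (d + 1)) := by field_simp; ring

section ValueError

variable (d : ℕ) {F : (Fin 2 → ℝ) → ℝ}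

/-- The Euclidean increment bound: `|F(p₀−s, p₁−t) − F(p)| ≤ B₁ (|s| + |t|)` from a gradient bound `B₁` of `F` read on `ℝ²` (Euclidean). -/
theorem abs_sub_le_of_fderiv_le (hdiff : Differentiable ℝ fun q : EuclideanSpace ℝ (Fin 2) => F (WithLp.ofLp q)) {B₁ : ℝ}
    (hB : ∀ x, ‖fderiv ℝ (fun q : EuclideanSpace ℝ (Fin 2) => F (WithLp.ofLp q)) x‖ ≤ B₁) (p : Fin 2 → ℝ) (s t : ℝ) :
    |F ![p 0 - s, p 1 - t] - F p| ≤ B₁ * (|s| + |t|) := by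
  set G : EuclideanSpace ℝ (Fin 2) → ℝ := fun q => F (WithLp.ofLp q) with hG
  have hmv := Convex.norm_image_sub_le_of_norm_fderiv_le (f := G) (fun x _ => hdiff x) (fun x _ => hB x) convex_univ
    (Set.mem_univ (WithLp.toLp 2 p)) (Set.mem_univ (WithLp.toLp 2 ![p 0 - s, p 1 - t]))
  have hGy : G (WithLp.toLp 2 ![p 0 - s, p 1 - t]) = F ![p 0 - s, p 1 - t] := rfl
  have hGx : G (WithLp.toLp 2 p) = F p := rfl
  rw [hGy, hGx, Real.norm_eq_abs] at hmv
  have hnorm : ‖WithLp.toLp 2 ![p 0 - s, p 1 - t] - WithLp.toLp 2 p‖ ≤ |s| + |t| := by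
    rw [← WithLp.toLp_sub, EuclideanSpace.norm_eq]
    simp only [Fin.sum_univ_two, Pi.sub_apply, Matrix.cons_val_zero, Matrix.cons_val_one, Real.norm_eq_abs]
    rw [show p 0 - s - p 0 = -s by ring, show p 1 - t - p 1 = -t by ring, abs_neg, abs_neg,
      Real.sqrt_le_left (by positivity)]
    nlinarith [abs_nonneg s, abs_nonneg t, sq_abs s, sq_abs t]
  have hB0 : 0 ≤ B₁ := le_trans (norm_nonneg _) (hB (WithLp.toLp 2 p))
  calc |F ![p 0 - s, p 1 - t] - F p| ≤ B₁ * ‖WithLp.toLp 2 ![p 0 - s, p 1 - t] - WithLp.toLp 2 p‖ := hmv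
    _ ≤ B₁ * (|s| + |t|) := mul_le_mul_of_nonneg_left hnorm hB0

/-- **(J3) The value error of the Jackson mean**: `|𝒥_d F(p) − F(p)| ≤ π⁶·B₁/(d+1)` for a continuous `F` with gradient bound `B₁`
(only ONE derivative is spent; `d` is free). -/
theorem abs_jsmooth_sub_self_le (hF : Continuous F)
    (hdiff : Differentiable ℝ fun q : EuclideanSpace ℝ (Fin 2) => F (WithLp.ofLp q)) {B₁ : ℝ}
    (hB : ∀ x, ‖fderiv ℝ (fun q : EuclideanSpace ℝ (Fin 2) => F (WithLp.ofLp q)) x‖ ≤ B₁) (p : Fin 2 → ℝ) :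
    |jsmooth d F p - F p| ≤ π ^ 6 / (d + 1) * B₁ := by
  have hππ : -π ≤ π := by linarith [Real.pi_pos]
  have hB0 : 0 ≤ B₁ := le_trans (norm_nonneg _) (hB (WithLp.toLp 2 p))
  set M : ℝ := π ^ 6 / (2 * (d + 1)) with hM
  have hM1 := integral_abs_mul_jker_le d
  -- `𝒥F(p) − F(p) = 𝒥(F − F(p))(p)`
  have hc : Continuous fun q : Fin 2 → ℝ => F q - F p := hF.sub continuous_const
  have hrepr : jsmooth d F p - F p = jsmooth d (fun q => F q - F p) p := by
    rw [jsmooth_sub d hF continuous_const, jsmooth_const]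
  rw [hrepr]
  unfold jsmooth
  -- inner bound
  have hinner : ∀ s, |∫ t in (-π)..π, jker d s * jker d t * (F ![p 0 - s, p 1 - t] - F p)| ≤ jker d s * (B₁ * (|s| + M)) := by
    intro s
    have hjs := jker_nonneg d s
    calc |∫ t in (-π)..π, jker d s * jker d t * (F ![p 0 - s, p 1 - t] - F p)|
        ≤ ∫ t in (-π)..π, |jker d s * jker d t * (F ![p 0 - s, p 1 - t] - F p)| :=
          intervalIntegral.abs_integral_le_integral_abs hππ
      _ ≤ ∫ t in (-π)..π, jker d s * B₁ * |s| * jker d t + jker d s * B₁ * (|t| * jker d t) := by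
          refine intervalIntegral.integral_mono_on hππ
            ((continuous_jsmoothIntegrand_snd d hc p s).abs.intervalIntegrable _ _)
            (Continuous.intervalIntegrable
              ((continuous_const.mul (continuous_jker d)).add
                (continuous_const.mul (continuous_abs.mul (continuous_jker d)))) _ _)
            fun t _ => ?_
          rw [abs_mul, abs_mul, abs_of_nonneg hjs, abs_of_nonneg (jker_nonneg d t)]
          have hinc := abs_sub_le_of_fderiv_le hdiff hB p s t
          have hjj : 0 ≤ jker d s * jker d t := mul_nonneg hjs (jker_nonneg d t)
          nlinarith
      _ = jker d s * B₁ * |s| + jker d s * B₁ * ∫ t in (-π)..π, |t| * jker d t := by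
          have i1 : IntervalIntegrable (fun t => jker d s * B₁ * |s| * jker d t) volume (-π) π :=
            (continuous_const.mul (continuous_jker d)).intervalIntegrable _ _
          have i2 : IntervalIntegrable (fun t => jker d s * B₁ * (|t| * jker d t)) volume (-π) π :=
            (continuous_const.mul (continuous_abs.mul (continuous_jker d))).intervalIntegrable _ _
          rw [intervalIntegral.integral_add i1 i2, intervalIntegral.integral_const_mul, intervalIntegral.integral_const_mul,
            integral_jker, mul_one]
      _ ≤ jker d s * (B₁ * (|s| + M)) := by
          have : jker d s * B₁ * ∫ t in (-π)..π, |t| * jker d t ≤ jker d s * B₁ * M :=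
            mul_le_mul_of_nonneg_left hM1 (mul_nonneg hjs hB0)
          nlinarith
  -- outer bound
  calc |∫ s in (-π)..π, ∫ t in (-π)..π, jker d s * jker d t * (F ![p 0 - s, p 1 - t] - F p)|
      ≤ ∫ s in (-π)..π, |∫ t in (-π)..π, jker d s * jker d t * (F ![p 0 - s, p 1 - t] - F p)| :=
        intervalIntegral.abs_integral_le_integral_abs hππ
    _ ≤ ∫ s in (-π)..π, B₁ * M * jker d s + B₁ * (|s| * jker d s) := by
        refine intervalIntegral.integral_mono_on hππ ((continuous_jsmoothInner d hc p).abs.intervalIntegrable _ _)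
          (Continuous.intervalIntegrable ((continuous_const.mul (continuous_jker d)).add
            (continuous_const.mul (continuous_abs.mul (continuous_jker d)))) _ _) fun s _ => ?_
        have := hinner s
        nlinarith [jker_nonneg d s]
    _ = B₁ * M + B₁ * ∫ s in (-π)..π, |s| * jker d s := by
        have i1 : IntervalIntegrable (fun s => B₁ * M * jker d s) volume (-π) π :=
          (continuous_const.mul (continuous_jker d)).intervalIntegrable _ _
        have i2 : IntervalIntegrable (fun s => B₁ * (|s| * jker d s)) volume (-π) π :=
          (continuous_const.mul (continuous_abs.mul (continuous_jker d))).intervalIntegrable _ _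
        rw [intervalIntegral.integral_add i1 i2, intervalIntegral.integral_const_mul, intervalIntegral.integral_const_mul,
          integral_jker, mul_one]
    _ ≤ B₁ * M + B₁ * M := by gcongr
    _ = π ^ 6 / (d + 1) * B₁ := by rw [hM]; field_simp; ring

end ValueError

end Summit.HubbardSuperconductivity.HubbardSuperconductivity.Theorems.KLRegimeSplit

end
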